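import Mathlib
import Summits.NavierStokesRegularity.NavierStokesRegularity.Theorems.EulerZoomLiouvillePowerGaugeEulerLiouvillePressureBudgetScaleRepAssembly
import Summits.NavierStokesRegularity.NavierStokesRegularity.Theorems.EulerZoomLiouvillePowerGaugeEulerLiouvillePressureBudgetNearFieldLogMember
import Summits.NavierStokesRegularity.NavierStokesRegularity.Theorems.EulerZoomLiouvillePowerGaugeEulerLiouvillePressureBudgetLocalise
import Summits.NavierStokesRegularity.NavierStokesRegularity.Theorems.EulerZoomLiouvillePowerGaugeEulerLiouvillePressureBudgetWeakPressureEquation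
import Summits.NavierStokesRegularity.NavierStokesRegularity.Theorems.EulerZoomLiouvillePowerGaugeEulerLiouvillePressureBudgetRieszModConst
import Summits.NavierStokesRegularity.NavierStokesRegularity.Theorems.EulerZoomLiouvillePowerGaugeEulerLiouvillePressureBudgetLiouvilleModConst
import Summits.NavierStokesRegularity.NavierStokesRegularity.Theorems.EulerZoomLiouvillePowerGaugeEulerLiouvilleWeakTraceLog
import Summits.NavierStokesRegularity.NavierStokesRegularity.Theorems.EulerZoomLiouvillePowerGaugeEulerLiouvillePressureBudgetGradPressureL1Growth
import HarnessLib

/-!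
# Crux `EulerZoomLiouville.PowerGaugeEulerLiouville` (stmt-NavierStokesRegularity-19832), nsreg-p2 ROUND-58 plate t60-ΠLOG:
# THE COMPOSITION — ΠLOG UNCONDITIONAL, and the weak trace law with a logarithm with NO pressure hypothesis (`0 < ρ ≤ 1`)

Seat ns-ezl-w3 g9, COMPOSER of record for t60-ΠLOG (LEAD 19832 g16 KEY S58c-A; `--supports stmt-NavierStokesRegularity-19832 --as helper`).
Everything BY NAME over landed pieces (texts = nsreg-p2 g45's `r58/Sketch58b.lean` 16d8b95ef8e183bb and `r58/Sketch58c.lean` c6fe466b7b48535d, VERBATIM):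

* (1)  `SteinNearOne` — `Literature.Analysis.FluidPDE.exists_eLpNorm_normalisedPressure_le_near_one[_of_contDiff_two]` (nsreg-typer g28, p718846/p719229);
* (1′) `NearFieldLog` — `PressureSeam.nearFieldLog` (ns-ezl-w3 g9, p719248 + member);
* S1   `WeakPressureEquation` — `PressureSeam.weakPressureEquation` (ns-ezl-w2 g7, p719382);
* S2   `GradPressureL1Growth` — `PressureSeam.gradPressureL1Growth` over `Literature…IsSelfSimilarEulerProfile.exists_integral_ball_norm_gradient_pressure_le` (nsreg-typer g28, p719937; member landed by the composer);
* S3   `Localise` — `PressureSeam.localise` (ns-sfl-p1 g10, p719440);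
* S4   `RieszModConst` — `PressureSeam.rieszModConst` (ns-ezl-w1 g10);
* S5   `LiouvilleModConst` — `PressureSeam.liouvilleModConst` (ns-sfl-p1 g10);
* A    `ScaleRepAssembly` — `PressureSeam.scaleRepAssembly` (ns-ezl-w3 g9, p720053); `PiLogAssembly` — `PressureSeam.piLogAssembly` (p718819);
* seam `PressureSeam.consumes_mod` and the trace law `WeakTrace.weakTraceLawLog` (ns-ezl-w1 g9).

CONTENTS:
* ★ `PressureSeam.scaleRepresentation` — Sketch58b `ScaleRepresentation ρ`, `0 < ρ ≤ 1`, UNCONDITIONAL;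
* ★★ `PressureSeam.piLog` — Sketch58b `PiLog ρ` = t60-ΠLOG, `0 < ρ ≤ 1`, UNCONDITIONAL: every `C²` self-similar Euler profile `(V, P)` (`γ = 1/(2+ρ)`, centre
  `0`) with the E-budget and the velocity budget has the pressure budget with a logarithm MODULO CONSTANTS, `∫_{B_R}|P − c_R| ≤ D·R^{1−2ρ}(1 + log R)`;
* `PressureSeam.logBudget_two_le` — the seam `D·R^a(1 + log R) ≤ 3·max D 0·R^a·log R` (`R ≥ 2`);
* ★★ `PressureSeam.weakTraceLawLog_of_budgets` — THE END PRODUCT of R54–R58: for `0 < ρ ≤ 1` the `𝒟′` TRACE LAW WITH A LOGARITHM holds for every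
  such profile and every `C¹_c` vector test, with NO pressure hypothesis (ΠLOG ⇒ `consumes_mod` (dyadic stabilisation `P ↦ P − κ`) ⇒ `weakTraceLawLog`).

HONEST FRAMING: instrument composition about HYPOTHETICAL profiles (portrait bookkeeping for THE ONE STATEMENT's class, Seregin's range `0 < ρ ≤ ½`
included); nothing about the crux E (19832 OPEN) or NS regularity is proved; not E.  MODEL lattice only.
-/

noncomputable section

-- flat `Theorems/<Route><Decl>…` files of one crux share the namespace of the crux (tree convention)
set_option linter.dupNamespace false

open MeasureTheory Metric Filter Topology
open scoped ENNReal NNReal Laplacian RealInnerProductSpace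

namespace Summit.NavierStokesRegularity.NavierStokesRegularity.Theorems.PowerGaugeEulerLiouville.PressureSeam

open Literature.Analysis.FluidPDE
open Summit.NavierStokesRegularity.NavierStokesRegularity.Theorems.PowerGaugeEulerLiouville

/-- ★ **Sketch58b `ScaleRepresentation ρ`, UNCONDITIONAL for `0 < ρ ≤ 1`** — S58c-A over (1′), S1–S5 by name: `P = c_R + p̃[w_R] + h_R` on `B_R`
with `w_R ∈ C²_c`, `w_R = V` on `B_{3R/2}`, `∫|w_R|² ≤ DR^{1−2ρ}`, `∫|∇w_R|² ≤ DR^{1−ρ}`, `∫_{B_R}|h_R| ≤ DR^{1−2ρ}`. -/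
theorem scaleRepresentation {ρ : ℝ} (hρ0 : 0 < ρ) (hρ1 : ρ ≤ 1) :
    ∀ (V : EuclideanSpace ℝ (Fin 3) → EuclideanSpace ℝ (Fin 3)) (P : EuclideanSpace ℝ (Fin 3) → ℝ),
      IsSelfSimilarEulerProfile (1 / (2 + ρ)) 0 V P →
        (∫⁻ y, ‖fderiv ℝ V y‖ₑ ^ 2 * ENNReal.ofReal (‖y‖ ^ (ρ - 1))) ≠ ⊤ →
        (∃ A : ℝ, ∀ R : ℝ, 1 ≤ R →
          ∫ y in ball (0 : EuclideanSpace ℝ (Fin 3)) R, ‖V y‖ ^ 2 ≤ A * R ^ (1 - 2 * ρ)) →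
        ∃ D : ℝ, ∀ R : ℝ, 1 ≤ R →
          ∃ (c : ℝ) (w : EuclideanSpace ℝ (Fin 3) → EuclideanSpace ℝ (Fin 3)) (h : EuclideanSpace ℝ (Fin 3) → ℝ),
            ContDiff ℝ 2 w ∧ HasCompactSupport w ∧
            (∀ y ∈ ball (0 : EuclideanSpace ℝ (Fin 3)) (3 * R / 2), w y = V y) ∧
            (∫ y, ‖w y‖ ^ 2) ≤ D * R ^ (1 - 2 * ρ) ∧
            (∫ y, ‖fderiv ℝ w y‖ ^ 2) ≤ D * R ^ (1 - ρ) ∧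
            IntegrableOn h (ball (0 : EuclideanSpace ℝ (Fin 3)) R) volume ∧
            (∫ y in ball (0 : EuclideanSpace ℝ (Fin 3)) R, |h y|) ≤ D * R ^ (1 - 2 * ρ) ∧
            ∀ y ∈ ball (0 : EuclideanSpace ℝ (Fin 3)) R, P y = c + normalisedPressure w y + h y :=
  scaleRepAssembly ρ hρ0 hρ1 nearFieldLog (localise ρ) (rieszModConst ρ) weakPressureEquation
    (gradPressureL1Growth (by linarith)) (liouvilleModConst ρ)

/-- ★★ **t60-ΠLOG, UNCONDITIONAL for `0 < ρ ≤ 1`** (= Sketch58b `PiLog ρ` VERBATIM, target = the tree's `PressureSeam.PressureBudgetLogMod`):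
every `C²` self-similar Euler profile `(V, P)` (`γ = 1/(2+ρ)`, centre `0`) with the E-budget `∫|∇V|²|y|^{ρ−1} < ∞` and the velocity budget
`∫_{B_R}|V|² ≤ AR^{1−2ρ}` has the PRESSURE BUDGET WITH A LOGARITHM MODULO CONSTANTS: `∃ D, ∀ R ≥ 1, ∃ c_R, ∫_{B_R}|P − c_R| ≤ D·R^{1−2ρ}(1 + log R)`.
[nsreg-p2 R55 §Π / R57 §5 / R58 SEEDS-R58 S2; Stein 1970 Ch. II §6.2 (a) for the logarithm's source] -/
theorem piLog {ρ : ℝ} (hρ0 : 0 < ρ) (hρ1 : ρ ≤ 1) :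
    ∀ (V : EuclideanSpace ℝ (Fin 3) → EuclideanSpace ℝ (Fin 3)) (P : EuclideanSpace ℝ (Fin 3) → ℝ),
      IsSelfSimilarEulerProfile (1 / (2 + ρ)) 0 V P →
        (∫⁻ y, ‖fderiv ℝ V y‖ₑ ^ 2 * ENNReal.ofReal (‖y‖ ^ (ρ - 1))) ≠ ⊤ →
        (∃ A : ℝ, ∀ R : ℝ, 1 ≤ R →
          ∫ y in ball (0 : EuclideanSpace ℝ (Fin 3)) R, ‖V y‖ ^ 2 ≤ A * R ^ (1 - 2 * ρ)) →
        PressureBudgetLogMod ρ P :=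
  piLogAssembly ρ nearFieldLog (scaleRepresentation hρ0 hρ1)

/-- The seam between the two log-budget shapes: for `R ≥ 2`, `D·(R^a(1 + log R)) ≤ 3·max D 0·R^a·log R` (`1 ≤ 2 log R` as `log 2 > ½`). -/
theorem logBudget_two_le {D a R : ℝ} (hR : 2 ≤ R) :
    D * (R ^ a * (1 + Real.log R)) ≤ 3 * max D 0 * R ^ a * Real.log R := by
  have hR0 : 0 < R := by linarith
  have hlog2 : (1 : ℝ) / 2 < Real.log 2 := by
    have := Real.log_two_gt_d9; norm_num at this; linarith
  have hlogR : Real.log 2 ≤ Real.log R := Real.log_le_log two_pos hR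
  have hRa : 0 ≤ R ^ a := (Real.rpow_pos_of_pos hR0 _).le
  have h1 : 1 + Real.log R ≤ 3 * Real.log R := by linarith
  have h0 : 0 ≤ 1 + Real.log R := by linarith
  calc D * (R ^ a * (1 + Real.log R)) ≤ max D 0 * (R ^ a * (1 + Real.log R)) :=
        mul_le_mul_of_nonneg_right (le_max_left _ _) (mul_nonneg hRa h0)
    _ ≤ max D 0 * (R ^ a * (3 * Real.log R)) :=
        mul_le_mul_of_nonneg_left (mul_le_mul_of_nonneg_left h1 hRa) (le_max_right _ _)
    _ = 3 * max D 0 * R ^ a * Real.log R := by ring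

/-- ★★ **THE END PRODUCT OF THE TRACE PROGRAMME (R54–R58), UNCONDITIONAL in the pressure**: for `0 < ρ ≤ 1`, every `C²` self-similar Euler
profile `(V, P)` (`γ = 1/(2+ρ)`, centre `0`) with the E-budget and the velocity budget obeys R54's `𝒟′` TRACE LAW WITH A LOGARITHM for every
`C¹_c` vector test `φ`: there are `L, C` with `|l^{ρ−2}∫⟪V, φ(l⁻¹·)⟫ − L| ≤ C l^{−(2+ρ)}(1 + log l)` for `l ≥ 2`.  ΠLOG (mod constants) ⇒
`PressureSeam.consumes_mod` (stabilisation, `P ↦ P − κ` is again a profile pressure) ⇒ `WeakTrace.weakTraceLawLog`.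
[nsreg-p2 R54 §C t59-TR / R56 t60-WTLOG / R57 t60-SEAM / R58 t60-ΠLOG; cite: ConstantinIgnatovaVicol2026Putative, §3.4.1] -/
theorem weakTraceLawLog_of_budgets {ρ : ℝ} (hρ0 : 0 < ρ) (hρ1 : ρ ≤ 1)
    {V : EuclideanSpace ℝ (Fin 3) → EuclideanSpace ℝ (Fin 3)} {P : EuclideanSpace ℝ (Fin 3) → ℝ}
    (hprof : IsSelfSimilarEulerProfile (1 / (2 + ρ)) 0 V P)
    (hE : (∫⁻ y, ‖fderiv ℝ V y‖ₑ ^ 2 * ENNReal.ofReal (‖y‖ ^ (ρ - 1))) ≠ ⊤)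
    (hA : ∃ A : ℝ, ∀ R : ℝ, 1 ≤ R → ∫ y in ball (0 : EuclideanSpace ℝ (Fin 3)) R, ‖V y‖ ^ 2 ≤ A * R ^ (1 - 2 * ρ)) :
    ∀ φ : EuclideanSpace ℝ (Fin 3) → EuclideanSpace ℝ (Fin 3), ContDiff ℝ 1 φ → HasCompactSupport φ →
      ∃ L C : ℝ, ∀ l : ℝ, 2 ≤ l →
        |l ^ (ρ - 2) * (∫ y, ⟪V y, φ (l⁻¹ • y)⟫) - L| ≤ C * l ^ (-(2 + ρ)) * (1 + Real.log l) := by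
  have hmod : PressureBudgetLogMod ρ P := piLog hρ0 hρ1 V P hprof hE hA
  refine consumes_mod (ρ := ρ) (γ := 1 / (2 + ρ)) (V := V) (by linarith)
    (Concl := ∀ φ : EuclideanSpace ℝ (Fin 3) → EuclideanSpace ℝ (Fin 3), ContDiff ℝ 1 φ → HasCompactSupport φ →
      ∃ L C : ℝ, ∀ l : ℝ, 2 ≤ l →
        |l ^ (ρ - 2) * (∫ y, ⟪V y, φ (l⁻¹ • y)⟫) - L| ≤ C * l ^ (-(2 + ρ)) * (1 + Real.log l))
    (fun P' hprof' hlog => ?_) hprof hmod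
  obtain ⟨D, hD⟩ := hlog
  refine WeakTrace.weakTraceLawLog (by linarith) V P' hprof' hA ⟨3 * max D 0, fun R hR => ?_⟩
  exact (hD R (by linarith)).trans (logBudget_two_le hR)

end Summit.NavierStokesRegularity.NavierStokesRegularity.Theorems.PowerGaugeEulerLiouville.PressureSeam

end
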